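import Mathlib.MeasureTheory.Function.ContinuousMapDense
import Summits.AtomisticToContinuum.FouriersLaw.Theorems.BondHeatUncertaintyExtensiveSnapshotIrreversibilityCorrectorIntegrability
import Summits.AtomisticToContinuum.FouriersLaw.Theorems.OddSectorIrreversibilityOddDensityIsCorrectorStationarity
import Summits.AtomisticToContinuum.FouriersLaw.Theorems.OddSectorIrreversibilityOddDensityIsCorrectorAbelLimit
import Summits.AtomisticToContinuum.FouriersLaw.Theorems.OddSectorIrreversibilityOddDensityIsCorrectorIdentificationKey
import Literature.MathematicalPhysics.KineticTheory.LangevinChainKernel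
import Literature.MathematicalPhysics.KineticTheory.LangevinChainGibbs
import HarnessLib

/-!
# Crux `ExtensiveSnapshotIrreversibility` (stmt-AtomisticToContinuum-9121), line `clausius-budget-sound-window`:
stub `stub_mcLennanIdentification`

Registered stub of the lead's checked skeleton `Cruxes/ExtensiveSnapshotIrreversibility/Lines/clausius-budget-sound-window.lean`
(v3; namespace `…Cruxes.ExtensiveSnapshotIrreversibility.ClausiusBudgetSoundWindow`), proved verbatim (name + signature) so that
`ledger propose --supports stmt-AtomisticToContinuum-9121` accepts it.

Content (the McLennan formula for the momentum-odd part of the linear-response density). For the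
pinned anharmonic chain `P = pinnedChain ω₂ lam β γ` at fixed `N ≥ 2` with both baths at `T > 0`
(equilibrium kernels `P_t`, Gibbs state `μ_T`, momentum flip `Θ(q,p) = (q,-p)`), let `h ∈ L²` be a
linear-response density of the steady-state family `δ ↦ μ_{N,T+δ/2,T-δ/2}` at `δ = 0` and let
`w = ∫₀^∞ P_s g ds` be the McLennan corrector of the contact source `g = (γ/2T²)(p_0² - p_{N-1}²)`.
Then `h - h∘Θ = w∘Θ - w` `μ_T`-a.e. (`ae_eq_flip_defect_of_weak_adjoint`), hence
`∫ (h - h∘Θ)² dμ_T = ∫ (w - w∘Θ)² dμ_T` (`stub_mcLennanIdentification`).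

Route: weak-NESS uniqueness gives `μ_{N,T,T} = μ_T`; differentiating weak stationarity gives the
weak adjoint equation `∫ (LF) h dμ_T = -∫ F g dμ_T` (`integral_generator_mul_responseDensity_gibbs`,
tree); the key estimate of item 9146 (`pinnedChain_key_estimate`) bounds `∫ (h - W_λ∘Θ)² dμ_T` by
`8 ∫ (h - h₁)² dμ_T`, `W_λ = R_λ g + λ R_λ(h₁∘Θ)`, `R_λ = ∫₀^∞ e^{-λt} P_t dt`, for bounded continuous
`h₁`; the Abel limits `R_λ g → w`, `λR_λ(h₁∘Θ) → μ_T(h₁∘Θ)` hold with rate `O(λ) e^{ϑH}` (Harris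
bound, CEHR (2.5); `μ_T(g) = 0` by the symmetry `p_0 ↔ p_{N-1}`), `e^{ϑH} ∈ L²(μ_T)`; the constants
cancel in `W_λ∘Θ - W_λ`, and bounded continuous functions are dense in `L²(μ_T)`.

References: J. A. McLennan, Phys. Rev. 115 (1959) 1405; C. Maes, K. Netočný, J. Math. Phys. 51
(2010) 015219, Thm 3.1; A. Kundu, A. Dhar, O. Narayan, J. Stat. Mech. (2009) L03001, (reln2);
N. Cuneo, J.-P. Eckmann, M. Hairer, L. Rey-Bellet, EJP 23 (2018) no. 55, Thm 2.13 (3) eq. (2.5).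
-/

noncomputable section

namespace Summit.AtomisticToContinuum.FouriersLaw.Theorems.ExtensiveSnapshotIrreversibility.ClausiusBudget

open MeasureTheory Filter Topology Set
open scoped ENNReal NNReal ContDiff
open Literature.MathematicalPhysics.KineticTheory.HeatConduction
open Summit.AtomisticToContinuum.FouriersLaw.Theorems.OddSectorIrreversibility
open Summit.AtomisticToContinuum.FouriersLaw.Theorems.SubdiffusiveBondHeat

section Helpers

variable {N : ℕ}

omit N in
/-- `(a - b + (c - d))² ≤ 4 (a² + b² + c² + d²)` (Cauchy–Schwarz for four terms). [folklore] -/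
theorem sq_sub_add_sub_le_four (a b c d : ℝ) :
    (a - b + (c - d)) ^ 2 ≤ 4 * (a ^ 2 + b ^ 2 + c ^ 2 + d ^ 2) := by
  nlinarith [sq_nonneg (a + b), sq_nonneg (a - c), sq_nonneg (a + d), sq_nonneg (b + c),
    sq_nonneg (b - d), sq_nonneg (c + d)]

/-- `e^{ϑx}² = e^{2ϑx}`. [folklore] -/
theorem exp_mul_sq (ϑ x : ℝ) : Real.exp (ϑ * x) ^ 2 = Real.exp (2 * ϑ * x) := by
  rw [sq, ← Real.exp_add]; congr 1; ring

variable {ω₂ lam β γ : ℝ} (hω : 0 < ω₂) (hl : 0 ≤ lam) (hβ : 0 < β) (hγ : 0 < γ) (hN : 2 ≤ N)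
  {T : ℝ} (hT : 0 < T)
include hω hl hβ hγ hN hT

/-- **The McLennan formula for the flip defect of a weak solution of `L†h = -g`.** For the pinned
anharmonic chain at equilibrium (`ω₂ > 0`, `lam ≥ 0`, `β, γ > 0`, `N ≥ 2`, `T > 0`; kernels `P_t`,
Gibbs state `μ_T`), let `g` be a nice source — continuous, `|g| ≤ C_g e^{ϑH}` with `0 < ϑ`,
`2ϑ < 1/T`, even in the momenta and centred (`μ_T(g) = 0`) — and let `h ∈ L²(μ_T)` be measurable
with `∫ (LF) h dμ_T = -∫ F g dμ_T` for every test function `F`. Then with the Kubo/McLennan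
corrector `w(z) = ∫_{(0,∞)} P_t g(z) dt`:  `h - h∘Θ = w∘Θ - w`  `μ_T`-a.e., `Θ(q,p) = (q,-p)`.
Proof: the key estimate `∫ (h - W_λ∘Θ)² ≤ 8 ∫ (h - h₁)²` (`W_λ = R_λ g + λR_λ(h₁∘Θ)`, any bounded
continuous `h₁`, `λ > 0`), the Abel limits `R_λ g → w`, `λR_λ(h₁∘Θ) → μ_T(h₁∘Θ)` with rate
`O(λ) e^{ϑH}` in sup norm, `e^{ϑH} ∈ L²(μ_T)`, and the density of bounded continuous functions in
`L²(μ_T)`; the constants cancel in `W_λ∘Θ - W_λ`.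
[cite: MaesNetocny2010, Thm 3.1] [cite: KunduDharNarayan2009, eq. (reln2)]
[cite: CuneoEckmannHairerReyBellet2018, Thm 2.13 eq. (2.5)] -/
theorem ae_eq_flip_defect_of_weak_adjoint {ϑ : ℝ} (hϑ0 : 0 < ϑ) (h2ϑ : 2 * ϑ < 1 / T)
    {g : PhaseSpace N → ℝ} (hgc : Continuous g) {Cg : ℝ} (hCg : 0 ≤ Cg)
    (hgb : ∀ y, |g y| ≤ Cg * Real.exp (ϑ * (pinnedChain ω₂ lam β γ).hamiltonian N y))
    (hge : ∀ y : PhaseSpace N, g (y.1, -y.2) = g y)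
    (hg0 : ∫ y, g y ∂((pinnedChain ω₂ lam β γ).gibbsMeasure N T) = 0)
    {h : PhaseSpace N → ℝ} (hhm : Measurable h) (hh : MemLp h 2 ((pinnedChain ω₂ lam β γ).gibbsMeasure N T))
    (hweak : ∀ F : PhaseSpace N → ℝ, ContDiff ℝ ∞ F → HasCompactSupport F →
      ∫ x, (pinnedChain ω₂ lam β γ).generator N T T F x * h x ∂((pinnedChain ω₂ lam β γ).gibbsMeasure N T) =
        -∫ x, F x * g x ∂((pinnedChain ω₂ lam β γ).gibbsMeasure N T))
    (w : PhaseSpace N → ℝ)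
    (hw : w = fun z => ∫ t in Ioi (0 : ℝ),
      ∫ y, g y ∂((pinnedChain ω₂ lam β γ).transitionKernel N T T t.toNNReal z)) :
    (fun z => h z - h (z.1, -z.2)) =ᵐ[(pinnedChain ω₂ lam β γ).gibbsMeasure N T]
      fun z => w (z.1, -z.2) - w z := by
  set P := pinnedChain ω₂ lam β γ with hP
  set π := P.gibbsMeasure N T with hπ
  have hN0 : 0 < N := by omega
  have hϑ1 : ϑ < 1 / T := by linarith
  haveI : IsProbabilityMeasure π := pinnedChain_isProbabilityMeasure_gibbsMeasure hω hl hβ.le γ N hT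
  have hΘm : Measurable (fun y : PhaseSpace N => ((y.1, -y.2) : PhaseSpace N)) := measurable_fst.prodMk measurable_snd.neg
  have hΘc : Continuous (fun y : PhaseSpace N => ((y.1, -y.2) : PhaseSpace N)) := continuous_fst.prodMk continuous_snd.neg
  have hmp : MeasurePreserving (momentumReversal N) π π := measurePreserving_reversal_gibbsMeasure P N T
  have hHΘ : ∀ y : PhaseSpace N, P.hamiltonian N (y.1, -y.2) = P.hamiltonian N y :=
    fun y => OscillatorChain.hamiltonian_neg_momentum P N y
  obtain ⟨K, c, hK, hc, hb⟩ := pinnedChain_harris_bound hω hl hβ hγ hN0 hT hϑ0 hϑ1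
  -- transport of square-integrability along `Θ`
  have hΘsq : ∀ {f : PhaseSpace N → ℝ}, Integrable (fun z => f z ^ 2) π →
      Integrable (fun z => f (z.1, -z.2) ^ 2) π := by
    intro f hf2
    have := (hmp.integrable_comp hf2.aestronglyMeasurable).2 hf2
    simpa [Function.comp_def, momentumReversal_apply] using this
  -- the exponential weight
  have hE2 : Integrable (fun z => Real.exp (2 * ϑ * P.hamiltonian N z)) π :=
    pinnedChain_integrable_exp_mul_hamiltonian_gibbsMeasure hω hl hβ.le γ N hT h2ϑ
  obtain ⟨M₂, hM₂⟩ : ∃ M : ℝ, M = ∫ z, Real.exp (2 * ϑ * P.hamiltonian N z) ∂π := ⟨_, rfl⟩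
  have hM₂0 : 0 ≤ M₂ := by rw [hM₂]; exact integral_nonneg fun z => (Real.exp_pos _).le
  -- the corrector `w`: measurable, `|w| ≤ (K C_g / c) e^{ϑH}`, square-integrable
  have hwm : Measurable w := by
    rw [hw]; exact (pinnedChain_stronglyMeasurable_kubo hω hl hβ.le hγ.le T T hgc.measurable).measurable
  have hwb : ∀ z, |w z| ≤ K * Cg * Real.exp (ϑ * P.hamiltonian N z) / c := fun z => by
    rw [hw]; exact pinnedChain_abs_kubo_le hω hl hβ hγ hb hc hgc hCg hgb hg0 z
  have hw2 : Integrable (fun z => w z ^ 2) π := by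
    refine (hE2.const_mul ((K * Cg / c) ^ 2)).mono' (hwm.pow_const 2).aestronglyMeasurable
      (Eventually.of_forall fun z => ?_)
    rw [Real.norm_eq_abs, abs_of_nonneg (sq_nonneg _)]
    have h1 : |w z| ≤ (K * Cg / c) * Real.exp (ϑ * P.hamiltonian N z) := by
      rw [div_mul_eq_mul_div]; exact hwb z
    calc w z ^ 2 = |w z| ^ 2 := (sq_abs _).symm
      _ ≤ ((K * Cg / c) * Real.exp (ϑ * P.hamiltonian N z)) ^ 2 := pow_le_pow_left₀ (abs_nonneg _) h1 2
      _ = (K * Cg / c) ^ 2 * Real.exp (2 * ϑ * P.hamiltonian N z) := by rw [mul_pow, exp_mul_sq]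
  have hwΘ2 : Integrable (fun z => w (z.1, -z.2) ^ 2) π := hΘsq hw2
  -- `h`
  have hh2 : Integrable (fun z => h z ^ 2) π := hh.integrable_sq
  have hhΘ2 : Integrable (fun z => h (z.1, -z.2) ^ 2) π := hΘsq hh2
  -- the defect `u = (h - h∘Θ) - (w∘Θ - w)`
  set u : PhaseSpace N → ℝ := fun z => (h z - h (z.1, -z.2)) - (w (z.1, -z.2) - w z) with hu
  have hum : Measurable u := (hhm.sub (hhm.comp hΘm)).sub ((hwm.comp hΘm).sub hwm)
  have hu2 : Integrable (fun z => u z ^ 2) π :=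
    (((hh2.add hhΘ2).add (hwΘ2.add hw2)).const_mul 4).mono' (hum.pow_const 2).aestronglyMeasurable
      (Eventually.of_forall fun z => by
        rw [Real.norm_eq_abs, abs_of_nonneg (sq_nonneg _)]
        simp only [hu, Pi.add_apply]
        nlinarith [sq_nonneg (h z - h (z.1, -z.2) + (w (z.1, -z.2) - w z)), sq_nonneg (h z + h (z.1, -z.2)),
          sq_nonneg (w (z.1, -z.2) + w z)])
  -- MAIN CLAIM: `∫ u² ≤ δ` for every `δ > 0`
  have hle : ∀ δ : ℝ, 0 < δ → ∫ z, u z ^ 2 ∂π ≤ δ := by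
    intro δ hδ
    -- (i) a bounded continuous `L²`-approximation `h₁` of `h`
    have hh' : MemLp h (ENNReal.ofReal 2) π := by rw [ENNReal.ofReal_ofNat]; exact hh
    obtain ⟨h₁, hh₁, -⟩ :=
      hh'.exists_boundedContinuous_integral_rpow_sub_le zero_lt_two (ε := δ / 128) (by positivity)
    have happ : ∫ z, (h z - h₁ z) ^ 2 ∂π ≤ δ / 128 := by
      have e : ∫ z, ‖h z - h₁ z‖ ^ (2 : ℝ) ∂π = ∫ z, (h z - h₁ z) ^ 2 ∂π := integral_congr_ae
        (Eventually.of_forall fun z => by simp only [Real.rpow_two, Real.norm_eq_abs, sq_abs])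
      rw [← e]; exact hh₁
    obtain ⟨B₁, hB₁⟩ : ∃ B : ℝ, B = ‖h₁‖ := ⟨_, rfl⟩
    have hB₁b : ∀ y, ‖h₁ y‖ ≤ B₁ := fun y => by rw [hB₁]; exact h₁.norm_coe_le_norm y
    have hB₁0 : 0 ≤ B₁ := by rw [hB₁]; exact norm_nonneg _
    have hh₁c : Continuous (h₁ : PhaseSpace N → ℝ) := h₁.continuous
    set h₁Θ : PhaseSpace N → ℝ := fun y => h₁ (y.1, -y.2) with hh₁Θ
    have hh₁Θc : Continuous h₁Θ := hh₁c.comp hΘc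
    have hh₁Θb : ∀ y, |h₁Θ y| ≤ B₁ * Real.exp (ϑ * P.hamiltonian N y) := fun y =>
      abs_le_exp_bound_of_bounded hω.le hl hβ.le γ hϑ0.le (fun y => hB₁b (y.1, -y.2)) y
    -- (ii) the choice of `λ`
    obtain ⟨K', hK'⟩ : ∃ K' : ℝ, K' = K * (Cg / c ^ 2 + B₁ / c) := ⟨_, rfl⟩
    have hK'0 : 0 ≤ K' := by rw [hK']; positivity
    obtain ⟨A, hA⟩ : ∃ A : ℝ, A = 8 * K' ^ 2 * M₂ + 1 := ⟨_, rfl⟩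
    have hA0 : 0 < A := by rw [hA]; positivity
    obtain ⟨lam', hlam'⟩ : ∃ l : ℝ, l = min 1 (δ / (2 * A)) := ⟨_, rfl⟩
    have hlam : 0 < lam' := by rw [hlam']; exact lt_min one_pos (by positivity)
    have hlam1 : lam' ≤ 1 := by rw [hlam']; exact min_le_left _ _
    have hlamA : lam' * A ≤ δ / 2 := by
      have : lam' ≤ δ / (2 * A) := by rw [hlam']; exact min_le_right _ _
      rw [le_div_iff₀ (by positivity)] at this
      linarith
    -- (iii) the key estimate
    set R : (PhaseSpace N → ℝ) → PhaseSpace N → ℝ := fun f z => ∫ t in Ioi (0 : ℝ), Real.exp (-(lam' * t)) *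
      ∫ y, f y ∂(P.transitionKernel N T T t.toNNReal z) with hR
    have hkey : ∫ z, (h z - (R g (z.1, -z.2) + lam' * R h₁Θ (z.1, -z.2))) ^ 2 ∂π ≤
        8 * ∫ z, (h z - h₁ z) ^ 2 ∂π :=
      pinnedChain_key_estimate hω hl hβ hγ hN hT hϑ0 h2ϑ hhm hh hgc hCg hgb hge hweak hh₁c hB₁b hlam
    -- (iv) square-integrability of `W = R g + λ R h₁Θ`, of `W∘Θ` and of `D = h - W∘Θ`
    have hRg := pinnedChain_integral_sq_resolvent_le hω hl hβ hγ hN0 hT hϑ0 h2ϑ hgc hCg hgb hlam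
    have hRh := pinnedChain_integral_sq_resolvent_le hω hl hβ hγ hN0 hT hϑ0 h2ϑ hh₁Θc hB₁0 hh₁Θb hlam
    have hRgm : Measurable (R g) :=
      (pinnedChain_stronglyMeasurable_resolvent hω hl hβ.le hγ.le T T hgc.measurable lam').measurable
    have hRhm : Measurable (R h₁Θ) :=
      (pinnedChain_stronglyMeasurable_resolvent hω hl hβ.le hγ.le T T hh₁Θc.measurable lam').measurable
    set W : PhaseSpace N → ℝ := fun z => R g z + lam' * R h₁Θ z with hW
    have hWm : Measurable W := hRgm.add (hRhm.const_mul lam')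
    have hRg2 : Integrable (fun z => R g z ^ 2) π := hRg.1
    have hRh2 : Integrable (fun z => R h₁Θ z ^ 2) π := hRh.1
    have hW2 : Integrable (fun z => W z ^ 2) π :=
      ((hRg2.add (hRh2.const_mul (lam' ^ 2))).const_mul 2).mono' (hWm.pow_const 2).aestronglyMeasurable
        (Eventually.of_forall fun z => by
          rw [Real.norm_eq_abs, abs_of_nonneg (sq_nonneg _)]
          simp only [hW, Pi.add_apply]
          nlinarith [sq_nonneg (R g z - lam' * R h₁Θ z)])
    have hWΘ2 : Integrable (fun z => W (z.1, -z.2) ^ 2) π := hΘsq hW2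
    set D : PhaseSpace N → ℝ := fun z => h z - W (z.1, -z.2) with hD
    have hDm : Measurable D := hhm.sub (hWm.comp hΘm)
    have hD2 : Integrable (fun z => D z ^ 2) π :=
      ((hh2.add hWΘ2).const_mul 2).mono' (hDm.pow_const 2).aestronglyMeasurable
        (Eventually.of_forall fun z => by
          rw [Real.norm_eq_abs, abs_of_nonneg (sq_nonneg _)]
          simp only [hD, Pi.add_apply]
          nlinarith [sq_nonneg (h z + W (z.1, -z.2))])
    have hDΘ2 : Integrable (fun z => D (z.1, -z.2) ^ 2) π := hΘsq hD2
    have hkeyD : ∫ z, D z ^ 2 ∂π ≤ δ / 16 := by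
      have e : ∫ z, D z ^ 2 ∂π = ∫ z, (h z - (R g (z.1, -z.2) + lam' * R h₁Θ (z.1, -z.2))) ^ 2 ∂π := rfl
      rw [e]; linarith [hkey, happ]
    have hDΘeq : ∫ z, D (z.1, -z.2) ^ 2 ∂π = ∫ z, D z ^ 2 ∂π :=
      integral_comp_reversal_gibbsMeasure P N T (fun z => D z ^ 2)
    -- (v) the Abel limits with rate
    set m : ℝ := ∫ y, h₁Θ y ∂π with hm
    set E : PhaseSpace N → ℝ := fun z => (R g z - w z) + (lam' * R h₁Θ z - m) with hE
    have hEb : ∀ z, |E z| ≤ lam' * K' * Real.exp (ϑ * P.hamiltonian N z) := by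
      intro z
      have h1 : |R g z - w z| ≤ lam' * (K * Cg * Real.exp (ϑ * P.hamiltonian N z)) / c ^ 2 := by
        rw [hw]; exact pinnedChain_abs_resolvent_sub_kubo_le hω hl hβ hγ hϑ0 hb hc hgc hCg hgb hg0 hlam z
      have h2 : |lam' * R h₁Θ z - m| ≤ lam' * (K * B₁ * Real.exp (ϑ * P.hamiltonian N z)) / c :=
        pinnedChain_abs_abelMean_sub_le hω hl hβ hγ hϑ0 hb hc hh₁Θc hB₁0 hh₁Θb hlam z
      calc |E z| ≤ |R g z - w z| + |lam' * R h₁Θ z - m| := abs_add_le _ _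
        _ ≤ lam' * (K * Cg * Real.exp (ϑ * P.hamiltonian N z)) / c ^ 2 +
            lam' * (K * B₁ * Real.exp (ϑ * P.hamiltonian N z)) / c := add_le_add h1 h2
        _ = lam' * K' * Real.exp (ϑ * P.hamiltonian N z) := by rw [hK']; field_simp
    have hEsq : ∀ z, E z ^ 2 ≤ (lam' * K') ^ 2 * Real.exp (2 * ϑ * P.hamiltonian N z) := fun z =>
      calc E z ^ 2 = |E z| ^ 2 := (sq_abs _).symm
        _ ≤ (lam' * K' * Real.exp (ϑ * P.hamiltonian N z)) ^ 2 := pow_le_pow_left₀ (abs_nonneg _) (hEb z) 2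
        _ = (lam' * K') ^ 2 * Real.exp (2 * ϑ * P.hamiltonian N z) := by rw [mul_pow, exp_mul_sq]
    -- (vi) the pointwise bound `u² ≤ 4 D² + 4 (D∘Θ)² + 8 (λK')² e^{2ϑH}`
    set bnd : PhaseSpace N → ℝ := fun z => 4 * D z ^ 2 + 4 * D (z.1, -z.2) ^ 2 +
      8 * (lam' * K') ^ 2 * Real.exp (2 * ϑ * P.hamiltonian N z) with hbnd
    have hbndi : Integrable bnd π := ((hD2.const_mul 4).add (hDΘ2.const_mul 4)).add (hE2.const_mul _)
    have hpt : ∀ z, u z ^ 2 ≤ bnd z := by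
      intro z
      have hid : u z = D z - D (z.1, -z.2) + (E (z.1, -z.2) - E z) := by
        simp only [hu, hD, hW, hE, neg_neg, Prod.mk.eta]; ring
      have h4 := sq_sub_add_sub_le_four (D z) (D (z.1, -z.2)) (E (z.1, -z.2)) (E z)
      have hE1 := hEsq z
      have hE2' : E (z.1, -z.2) ^ 2 ≤ (lam' * K') ^ 2 * Real.exp (2 * ϑ * P.hamiltonian N z) := by
        have := hEsq (z.1, -z.2); rwa [hHΘ] at this
      rw [hid]; simp only [hbnd]; linarith
    -- (vii) integrate
    have hI : ∫ z, u z ^ 2 ∂π ≤ ∫ z, bnd z ∂π :=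
      integral_mono_of_nonneg (Eventually.of_forall fun z => sq_nonneg (u z)) hbndi (Eventually.of_forall hpt)
    have hbndv : ∫ z, bnd z ∂π = 4 * (∫ z, D z ^ 2 ∂π) + 4 * (∫ z, D (z.1, -z.2) ^ 2 ∂π) +
        8 * (lam' * K') ^ 2 * M₂ := by
      have i1 : Integrable (fun z => 4 * D z ^ 2) π := hD2.const_mul 4
      have i2 : Integrable (fun z => 4 * D (z.1, -z.2) ^ 2) π := hDΘ2.const_mul 4
      have i3 : Integrable (fun z => 8 * (lam' * K') ^ 2 * Real.exp (2 * ϑ * P.hamiltonian N z)) π :=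
        hE2.const_mul _
      have i12 : Integrable (fun z => 4 * D z ^ 2 + 4 * D (z.1, -z.2) ^ 2) π := i1.add i2
      simp only [hbnd]
      rw [integral_add i12 i3, integral_add i1 i2, integral_const_mul, integral_const_mul,
        integral_const_mul, ← hM₂]
    have hlam2 : lam' ^ 2 ≤ lam' := by
      rw [sq]; exact (mul_le_mul_of_nonneg_left hlam1 hlam.le).trans_eq (mul_one _)
    have hK2M : 0 ≤ K' ^ 2 * M₂ := by positivity
    have hprod : lam' ^ 2 * (K' ^ 2 * M₂) ≤ lam' * (K' ^ 2 * M₂) := mul_le_mul_of_nonneg_right hlam2 hK2M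
    calc ∫ z, u z ^ 2 ∂π ≤ ∫ z, bnd z ∂π := hI
      _ = 8 * (∫ z, D z ^ 2 ∂π) + 8 * (lam' ^ 2 * (K' ^ 2 * M₂)) := by rw [hbndv, hDΘeq]; ring
      _ ≤ 8 * (δ / 16) + 8 * (lam' * (K' ^ 2 * M₂)) := by linarith [hkeyD, hprod]
      _ = δ / 2 + (lam' * A - lam') := by rw [hA]; ring
      _ ≤ δ := by linarith [hlam.le]
  -- conclusion: `u = 0` a.e.
  have hzero : ∫ z, u z ^ 2 ∂π = 0 :=
    le_antisymm (le_of_forall_pos_le_add fun δ hδ => by rw [zero_add]; exact hle δ hδ)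
      (integral_nonneg fun z => sq_nonneg _)
  have hu0 : (fun z => u z ^ 2) =ᵐ[π] 0 :=
    (integral_eq_zero_iff_of_nonneg (fun z => sq_nonneg (u z)) hu2).1 hzero
  filter_upwards [hu0] with z hz
  have hz' : u z = 0 := pow_eq_zero_iff two_ne_zero |>.1 hz
  simpa only [hu, sub_eq_zero] using hz'

end Helpers

/-- **McLennan identification of the flip defect of the response density (crux
`ExtensiveSnapshotIrreversibility`, line `clausius-budget-sound-window`, stub S1a).** For the pinned
chain `P = pinnedChain ω₂ lam β γ` (`ω₂, lam, β, γ > 0`), under weak-NESS uniqueness and along a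
steady-state family `μ`, at `T > 0`, `N ≥ 2`: given (INV), (MIX) and `w ∈ L²(μ_T)` for the McLennan
corrector `w = ∫_{(0,∞)} P_s g ds` of the contact source `g = (γ/2T²)(p_0² - p_{N-1}²)`
(`P_s = P.transitionKernel N T T s` the equilibrium kernels, `μ_T` the Gibbs state), EVERY `L²`
linear-response density `h` of `δ ↦ μ_{N,T+δ/2,T-δ/2}` at `δ = 0` (weak derivative tested on
`C_c^∞` observables and on the bond currents) satisfies
`∫ (h - h∘Θ)² d(μ N T T) = ∫ (w - w∘Θ)² dμ_T`, `Θ(q,p) = (q,-p)`.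
Proof: `μ N T T = μ_T` (uniqueness; the Gibbs state is a weak steady state); the weak adjoint
equation `∫ (L F) h dμ_T = -∫ F g dμ_T` (`integral_generator_mul_responseDensity_gibbs`); pass to a
measurable representative of `h`; `ae_eq_flip_defect_of_weak_adjoint` gives `h - h∘Θ = w∘Θ - w`
a.e. (the McLennan formula `h = w∘Θ + const`, in its flip-odd part), with `g` nice for
`ϑ = 1/(4T)` (`abs_mul_sq_sub_sq_le_exp`), even, and centred (`integral_sq_sub_sq_gibbsMeasure`).
The hypotheses (INV), (MIX) and `w ∈ L²` are implied by tree theorems and not used.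
[cite: MaesNetocny2010, Thm 3.1] [cite: KunduDharNarayan2009, eq. (reln2)]
[cite: CuneoEckmannHairerReyBellet2018, Thm 2.13 eq. (2.5)] -/
theorem stub_mcLennanIdentification :
    ∀ ω₂ lam β γ : ℝ, 0 < ω₂ → 0 < lam → 0 < β → 0 < γ →
      (∀ (N : ℕ) (T_L T_R : ℝ), 0 < T_L → 0 < T_R → ∀ μ ν : Measure (PhaseSpace N),
        (pinnedChain ω₂ lam β γ).IsSteadyState N T_L T_R μ →
        (pinnedChain ω₂ lam β γ).IsSteadyState N T_L T_R ν → μ = ν) →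
      ∀ μ : (N : ℕ) → ℝ → ℝ → Measure (PhaseSpace N),
        (∀ (N : ℕ) (T_L T_R : ℝ), 0 < T_L → 0 < T_R →
          (pinnedChain ω₂ lam β γ).IsSteadyState N T_L T_R (μ N T_L T_R)) →
        ∀ T : ℝ, 0 < T → ∀ (N : ℕ) (hN : 2 ≤ N),
          let P := pinnedChain ω₂ lam β γ
          let μT := P.gibbsMeasure N T
          (∀ t : ℝ≥0, μT.bind (P.transitionKernel N T T t) = μT) →
          (∀ ϑ : ℝ, 0 < ϑ → ϑ < 1 / T → ∃ C c : ℝ, 0 < C ∧ 0 < c ∧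
            ∀ (z : PhaseSpace N) (t : ℝ≥0) (f : PhaseSpace N → ℝ), Continuous f →
              (∀ y, |f y| ≤ Real.exp (ϑ * P.hamiltonian N y)) →
              |(∫ y, f y ∂(P.transitionKernel N T T t z)) - ∫ y, f y ∂μT| ≤
                C * Real.exp (ϑ * P.hamiltonian N z) * Real.exp (-c * t)) →
          let g : PhaseSpace N → ℝ := fun y =>
            γ / (2 * T ^ 2) * (y.2 ⟨0, by omega⟩ ^ 2 - y.2 ⟨N - 1, by omega⟩ ^ 2)
          let Pg : ℝ → PhaseSpace N → ℝ := fun s z => ∫ y, g y ∂(P.transitionKernel N T T s.toNNReal z)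
          let w : PhaseSpace N → ℝ := fun z => ∫ s in Set.Ioi (0 : ℝ), Pg s z
          MemLp w 2 μT →
          ∀ h : PhaseSpace N → ℝ,
            (MemLp h 2 (μ N T T) ∧
              (∀ F : PhaseSpace N → ℝ, ContDiff ℝ ((⊤ : ℕ∞) : WithTop ℕ∞) F → HasCompactSupport F →
                Tendsto (fun δ : ℝ => ((∫ x, F x ∂(μ N (T + δ / 2) (T - δ / 2))) - ∫ x, F x ∂(μ N T T)) / δ)
                  (𝓝[≠] (0 : ℝ)) (𝓝 (∫ x, F x * h x ∂(μ N T T)))) ∧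
              (∀ i : Fin N, Tendsto (fun δ : ℝ =>
                  ((∫ x, (pinnedChain ω₂ lam β γ).bondCurrent N i x ∂(μ N (T + δ / 2) (T - δ / 2))) -
                    ∫ x, (pinnedChain ω₂ lam β γ).bondCurrent N i x ∂(μ N T T)) / δ)
                  (𝓝[≠] (0 : ℝ)) (𝓝 (∫ x, (pinnedChain ω₂ lam β γ).bondCurrent N i x * h x ∂(μ N T T))))) →
            ∫ x, (h x - h (x.1, -x.2)) ^ 2 ∂(μ N T T) = ∫ z, (w z - w (z.1, -z.2)) ^ 2 ∂μT := by
  intro ω₂ lam β γ hω hl hβ hγ hU μ hμ T hT N hN P μT _hINV _hMIX g Pg w _hwL2 h hh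
  -- name the `let`s
  have hP : P = pinnedChain ω₂ lam β γ := rfl
  have hμT : μT = P.gibbsMeasure N T := rfl
  have hg : g = fun y : PhaseSpace N =>
      γ / (2 * T ^ 2) * (y.2 ⟨0, by omega⟩ ^ 2 - y.2 ⟨N - 1, by omega⟩ ^ 2) := rfl
  have hw : w = fun z => ∫ s in Set.Ioi (0 : ℝ),
      ∫ y, g y ∂(P.transitionKernel N T T s.toNNReal z) := rfl
  clear_value w Pg g μT P
  subst hP hμT
  clear Pg _hINV _hMIX _hwL2
  obtain ⟨hhL2, hresp, -⟩ := hh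
  -- (0) `μ N T T = μ_T`
  have hG : μ N T T = (pinnedChain ω₂ lam β γ).gibbsMeasure N T :=
    hU N T T hT hT _ _ (hμ N T T hT hT) (pinnedChain_isSteadyState_gibbsMeasure hω hl.le hβ.le γ N hT)
  -- (1) the weak adjoint equation (tree)
  have hweak : ∀ F : PhaseSpace N → ℝ, ContDiff ℝ ∞ F → HasCompactSupport F →
      ∫ x, (pinnedChain ω₂ lam β γ).generator N T T F x * h x ∂((pinnedChain ω₂ lam β γ).gibbsMeasure N T) =
        -∫ x, F x * g x ∂((pinnedChain ω₂ lam β γ).gibbsMeasure N T) := by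
    intro F hF hFc
    rw [hg]
    exact integral_generator_mul_responseDensity_gibbs hN hT μ hμ hG hresp hF hFc
  rw [hG] at hhL2 ⊢
  set π := (pinnedChain ω₂ lam β γ).gibbsMeasure N T with hπ
  -- (2) a measurable representative of `h`
  set h' : PhaseSpace N → ℝ := hhL2.1.mk h with hh'def
  have hh'm : Measurable h' := hhL2.1.stronglyMeasurable_mk.measurable
  have hae : h =ᵐ[π] h' := hhL2.1.ae_eq_mk
  have hh'L2 : MemLp h' 2 π := hhL2.ae_eq hae
  have hweak' : ∀ F : PhaseSpace N → ℝ, ContDiff ℝ ∞ F → HasCompactSupport F →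
      ∫ x, (pinnedChain ω₂ lam β γ).generator N T T F x * h' x ∂π = -∫ x, F x * g x ∂π := by
    intro F hF hFc
    rw [← hweak F hF hFc]
    exact integral_congr_ae (by filter_upwards [hae] with x hx; rw [hx])
  -- (3) the source `g` is nice, even and centred
  set ϑ : ℝ := 1 / (4 * T) with hϑ_def
  have hϑ0 : 0 < ϑ := by positivity
  have h2ϑ : 2 * ϑ < 1 / T := by
    have h1 : 2 * ϑ = 1 / T * (1 / 2) := by rw [hϑ_def]; field_simp; ring
    rw [h1]
    exact mul_lt_of_lt_one_right (by positivity) (by norm_num)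
  have hgc : Continuous g := by rw [hg]; fun_prop
  have hCg : 0 ≤ 4 * |γ / (2 * T ^ 2)| / ϑ := by positivity
  have hgb : ∀ y, |g y| ≤ 4 * |γ / (2 * T ^ 2)| / ϑ * Real.exp (ϑ * (pinnedChain ω₂ lam β γ).hamiltonian N y) :=
    fun y => by
      rw [hg]
      exact abs_mul_sq_sub_sq_le_exp hω.le hl.le hβ.le γ _ hϑ0 _ _ y
  have hge : ∀ y : PhaseSpace N, g (y.1, -y.2) = g y := fun y => by
    simp only [hg, Pi.neg_apply, neg_sq]
  have hg0 : ∫ y, g y ∂π = 0 := by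
    rw [hg]
    exact integral_sq_sub_sq_gibbsMeasure ω₂ lam β γ _ T _ _
  -- (4) the McLennan formula for `h'`, transported back to `h`
  have hmain := ae_eq_flip_defect_of_weak_adjoint hω hl.le hβ hγ hN hT hϑ0 h2ϑ hgc hCg hgb hge hg0 hh'm hh'L2
    hweak' w hw
  have hmp := measurePreserving_reversal_gibbsMeasure (pinnedChain ω₂ lam β γ) N T
  have haeΘ : (fun z => h (z.1, -z.2)) =ᵐ[π] fun z => h' (z.1, -z.2) := by
    have := hmp.quasiMeasurePreserving.ae_eq_comp hae
    simpa [Function.comp_def, momentumReversal_apply] using this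
  calc ∫ x, (h x - h (x.1, -x.2)) ^ 2 ∂π = ∫ x, (h' x - h' (x.1, -x.2)) ^ 2 ∂π :=
        integral_congr_ae (by filter_upwards [hae, haeΘ] with x h1 h2; rw [h1, h2])
    _ = ∫ z, (w (z.1, -z.2) - w z) ^ 2 ∂π :=
        integral_congr_ae (by filter_upwards [hmain] with z hz; rw [hz])
    _ = ∫ z, (w z - w (z.1, -z.2)) ^ 2 ∂π := integral_congr_ae (Eventually.of_forall fun z => by ring)

end Summit.AtomisticToContinuum.FouriersLaw.Theorems.ExtensiveSnapshotIrreversibility.ClausiusBudget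

end
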